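import Summits.QuantumFields.YangMills.Theorems.BalabanUVNodesN11NodeFacesAtCRLetteredMemberDoorOfBgFactsB
import Summits.QuantumFields.YangMills.Theorems.BalabanUVNodesN11Thm1PrintedAtCRLetteredMemberOfBgFactsWindowB
import Summits.QuantumFields.YangMills.Theorems.BalabanUVNodesN11K0DoorAtCRLetteredNumericsB
import Summits.QuantumFields.YangMills.Theorems.BalabanUVNodesN11CRLetteredMemberLetters

/-!
# DAG node N11 — THE EXPLICIT WINDOW `γ₁₁ⁿᵘᵐ(L, j, N) := min (e^{−(3L^j + 8L + 3)}) ((c′∕4)²)`, `c′ := min (16∕(3·36608)) (16·δ_N∕(8L)²)`, IN THE TYPE: the five γ-conditions of the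
# numeric rows for every `γ ∈ ]0, γ₁₁ⁿᵘᵐ]`, and the cR-lettered member's door faces (printed face, Theorem 1 ∕ p. 245 laws per window run, the `h11` family) keyed on
# `γ ≤ γ₁₁ⁿᵘᵐ(L, j, N)` VERBATIM — no existential over the window letter

HEADER — WORK-UNIT METADATA.  Cell `pub-ymgap`, YM-PLAN Track A (HUMAN RULING D-0062 ∕ D-0149 width seats), seat `pub-ymgap-dag-n11-w3` (g5; WIDTH SEAT 3∕4 on NODE n11 [B14]),
route `BalabanUVNodes` rev 29, item K1⁹ `StabilityBRunRowsAtRecordR13SepCoPHV` = stmt-QuantumFields-27364 (helper lane `--kind proof --supports 27364 --as helper`, count-neutral).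
ANSWER to ref-B g29 READ-864 INTERFACE NOTE on this seat's p633325 (pub-ymgap INBOX 2026-08-28 13:30Z: «the statement exposes γ₀ only EXISTENTIALLY — the header's explicit
`γ₁₁ⁿᵘᵐ(L, j, N)` lives in p608030's PROOF, in no theorem's type; a consumer needing the value must re-derive it»).  [III] = [Balaban1988Convergent], [15] = [Balaban1985Variational],
[I] = [Balaban1987RG1], [IV] = [Balaban1989LargeFieldI], [V] = [Balaban1989LargeFieldII], [B7] = [Balaban1985Averaging].  Over (BY NAME): this seat's g3 p608030 `…NoExpansionNumericsAtThm1CCMW`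
(`mul_log_inv_sq_le_four_sqrt`; its `exists_window_ccmShape` is the existential form of §1), `B14FlowStep.log_inv_sq`; dag-n11-w5 p631153 (★★★★★ `thm1Printed_gaussPinH_door_ccmwCR_of_supplierBorel_of_solvable_of_hjm`);
this seat's p631283 §2 (`thmP245Laws_gaussPinH_door_ccmwCR_of_supplierBorel_of_betaBox`), p634779 §3 (`h11Family_gaussPinH_door_ccmwCR_of_supplierBorel_of_betaBox`), g4 p620936 (the door theorem).

WHY THIS FILE.  Every «γ sufficiently small» statement of the member chain (p619867 §3, p622490, p631283 §3, p633325, p634779 §4) has the shape `∃ γ₀ > 0, ∀ γ ≤ γ₀, …` with the witness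
`γ₁₁ⁿᵘᵐ(L, j, N)` hidden in p608030's proof (`set A …; set c …; refine ⟨min (Real.exp (-A)) ((c / 4) ^ 2), …⟩`).  A consumer who must COMPARE the window with another letter (a K1 closer
choosing `γ` below several thresholds at once, or dag-n24-c's `h11` binder with its own `γ₁₁`) needs the VALUE.  §1 re-proves p608030 §1 with the value in the TYPE (same arithmetic, no new
idea); §2 keys the three door faces on `γ ≤ γ₁₁ⁿᵘᵐ(L, j, N)` spelled out.

SIBLING MODULE (director-ym №365 RENAME-AND-REDIRECT, 2026-08-30): this is `…BalabanUVNodesN11AtCRLetteredMemberDoorExplicitWindowB`, the residue-free sibling of `…BalabanUVNodesN11AtCRLetteredMemberDoorExplicitWindow` — SAME short decl names, the displayed [15]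
hypotheses re-typed to the ᴮ tokens (dag-n11-w1's R-road convention `(floorGuard F c₁₅, lamDatum F, Dat)` + ONE data-transfer binder `hDat₀`) and the Stage-2 SEAM displayed as ONE
hypothesis `hseam` (so the file is green BEFORE and AFTER node00-def-R's seam edit; post-seam users pass `fun _ _ _ _ _ => by rw [UbgOfRecord₁₃CoP_succ]`); imports re-pointed to the
residue-free twins `…K0DoorAtCRLetteredNumerics{,Z}B` ∕ `…BgRowGaugeRAtCRLetteredMemberB`, the letters bundles `…CRLetteredMemberLetters{,Z}` and the lower siblings.  The old module
is NOT edited (residue after the seam, R556 attic).  Count-neutral; nothing of Bałaban asserted.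
WHAT THIS FILE PROVES (5 theorems, 0 `def`, 0 `sorry`; standard axioms).
§1 (two `private` byte-identical copies of the residue module's scalar letters + their PUBLIC bundle ★ `explicitWindowLetters` = the pair of:) `explicitWindow_pos` (`0 < γ₁₁ⁿᵘᵐ(L, j, N)`) · ★ `ccmShape_of_le_explicitWindow` (`1 ≤ L`, `0 < γ ≤ γ₁₁ⁿᵘᵐ(L, j, N)` ⟹ `γ ≤ e^{−1}` ∧ `3·L^j ≤ L·log γ⁻²` ∧ `8L + 3 ≤ L·log γ⁻²` ∧
   `36608·γ·log γ⁻² ≤ 16∕3` ∧ `γ·log γ⁻² ≤ 16·δ_N∕(8L)²`).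
§2 at the member's history-blind door, `c ∈ [2, 8]`, `1 ≤ j`, `j + 1 ≤ F.m`, `0 < γ ≤ γ₁₁ⁿᵘᵐ(F.L, j, N)` EXPLICIT, Part 14 §0c's letters, per-window-run K0 solvability + [III] §3 supplier:
   ★★★★ `thm1Printed_gaussPinH_door_ccmwCR_of_le_explicitWindow` (key ∧ ∀ hG, `B16.Thm1Printed`) · ★★★★ `thmP245Laws_gaussPinH_door_ccmwCR_of_le_explicitWindow` (per window run: `∀ k ≤ K, SLaw` ∧
   `∀ k < K, SLaw → TLaw`) · ★★★★ `h11Family_gaussPinH_door_ccmwCR_of_le_explicitWindow` (key ∧ ∀ hG, dag-n24-c's `h11` family).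

HONEST FRAMING ∕ A6.  Helper lane, count-neutral KERNEL BOOKKEEPING (elementary real arithmetic of p608030 §1 restated with the witness exposed; three applications BY NAME); nothing of
Bałaban asserted.  DISPLAYED (hypotheses, NOT discharged, inhabited nowhere in the tree): (8) `VariationalThm1RegSepCoP7M`, the (9)-step `Gauge9RegSepTopStepR`, the sign-free windowed β-box
(`−bₗ·γ² ≤ 3`, `β′·γ² ≤ ¾`), K0's per-cube [15]-solvability on the windowed runs, [III] §3's supplier (`SupplierObligations ∧ SupplierBorel`) on the windowed runs.  NOT a re-pin (no `def`);
N11 NOT discharged; K0⁷ ∕ K1⁹ NOT closed, no stub touched; counts unmoved (typed 28∕28 · discharged 5∕27 · A 5∕28).  One finite `𝕋⁴_{L^K}` programme at fixed `ε = L^{−K}`;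
`route-QuantumFields-BalabanUVNodes` closes ONLY the CONDITIONAL finite-𝕋⁴ rung `BalabanLadder.UV` — NOT ℝ⁴, NOT OS, NOT the Yang–Mills mass gap (Clay).  No `sorry`, no `axiom`, no `def`,
no `instance`, no `notation`.
Sources (SHAPE only): [III] Thm 1 p.262, Theorem p.245, §3 p.279, (2.4)–(2.5) p.255, (2.10) p.256, (2.13) pp.256–257, (2.17) p.257, (2.28) p.259, (3.16)–(3.25) pp.268–270; [15] Thm 1 (7)–(10)
pp.278–279, (144)–(152) pp.300–301, Prop. 8 p.304; [I] Thm 1 p.259 («contained in an interval ]0, γ] with a sufficiently small positive γ»), (0.20) p.256, (1.20)–(1.22) p.264; [B7] Prop. 2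
p.26; [IV] (0.2)–(0.4) p.176, p.177 (i)–(ii); [V] Thm 1 + (0.1) pp.355–356.
-/

noncomputable section

open MeasureTheory
open scoped BigOperators ENNReal NNReal Matrix.Norms.L2Operator

namespace Summit.QuantumFields.YangMills.Theorems.BalabanUVNodesN11AtCRLetteredMemberDoorExplicitWindowB

open Literature.MathematicalPhysics.QuantumFieldTheory.Balaban1983to89 T4Continuum T4NestedCovariance Node00 Node00.Tk DagBinding
open B15DeterminingSets B8Eq17ClassAkV1 B14.Eq218Concrete B10Eq42TorusConstraint FlowStep
open B14.Eq213DetSet (Bj)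
open Literature.MathematicalPhysics.QuantumFieldTheory.BalabanImbrieJaffe1984to88.BIJ85Eq453GaugeField (qsstarGIter0)
open B14FlowStep (log_inv_sq)
open BalabanUVNodesN11HistoryPinnedResidualDefs BalabanUVNodesN11RePinnedParamDefs
open BalabanUVNodesN11GaussianCertificateDefs (gaussPinH)
open BalabanUVNodesN11Sect3SupplyChainDefs
open BalabanUVNodesN11Sect3SupplyChainBorelB
open BalabanUVNodesN11Sect3SupplyChainObligationsDefs
open BalabanUVNodesN11Sect3SupplyChainBorelBThm1PrintedOfSolvable (provisos₁₃SepCoPH_gaussPinH)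
open BalabanUVNodesN11NoExpansionNumericsAtThm1CCMW (mul_log_inv_sq_le_four_sqrt)
open BalabanUVNodesN11K0DoorAtCRLetteredNumericsB (hAdm_floorGuard_ccmwCR provisos₁₃SepCoPH_door_ccmwCR_of_gauge9TopStepGB_of_betaBoxSignFree_allTorus_lam)
open BalabanUVNodesN11CRLetteredMemberLetters (letters_ccmwCR)
open BalabanUVNodesN11Thm1PrintedAtCRLetteredMemberOfBgFactsB (thm1Printed_gaussPinH_door_ccmwCR_of_supplierBorel_of_solvable_of_hjm)
open BalabanUVNodesN11SupplyChainAtCRLetteredMemberOfBgFactsB (thmP245Laws_gaussPinH_door_ccmwCR_of_supplierBorel_of_betaBox)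
open BalabanUVNodesN11NodeFacesAtCRLetteredMemberDoorOfBgFactsB (h11Family_gaussPinH_door_ccmwCR_of_supplierBorel_of_betaBox)

/-! ## §1  The explicit window, value in the type -/

section Scalar

variable {L : ℕ}

/-- **`0 < γ₁₁ⁿᵘᵐ(L, j, N)`** — the explicit window `min (e^{−(3L^j + 8L + 3)}) ((c′∕4)²)`, `c′ := min (16∕(3·36608)) (16·δ_N∕(8L)²)`, is positive for `1 ≤ L`.
[cite: Balaban1987RG1, Thm 1 p.259 (bookkeeping numeral)] -/
private theorem explicitWindow_pos (hL : 1 ≤ L) (j N : ℕ) [NeZero N] :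
    0 < min (Real.exp (-(3 * (L : ℝ) ^ j + 8 * L + 3)))
      ((min (16 / (3 * 36608)) (16 * ExpMeanLog.deltaSU (Fin N) / ((8 * L : ℕ) : ℝ) ^ 2) / 4) ^ 2) := by
  have hL' : (1 : ℝ) ≤ L := by exact_mod_cast hL
  have hδ : 0 < ExpMeanLog.deltaSU (Fin N) := ExpMeanLog.deltaSU_pos
  have hc0 : 0 < min (16 / (3 * 36608)) (16 * ExpMeanLog.deltaSU (Fin N) / ((8 * L : ℕ) : ℝ) ^ 2) := lt_min (by norm_num) (by positivity)
  exact lt_min (Real.exp_pos _) (by positivity)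

/-- **★ THE FIVE γ-CONDITIONS OF THE NUMERIC ROWS ON THE EXPLICIT WINDOW `]0, γ₁₁ⁿᵘᵐ(L, j, N)]`, VALUE IN THE TYPE** (`1 ≤ L`): `γ ≤ e^{−1}`, `3·L^j ≤ L·log γ⁻²`, `8L + 3 ≤ L·log γ⁻²`,
`36608·γ·log γ⁻² ≤ 16∕3`, `γ·log γ⁻² ≤ 16·δ_N∕(8L)²` — this seat's g3 `exists_window_ccmShape` (p608030 §1) with its witness EXPOSED (same arithmetic: `log γ⁻² ≥ 2(3L^j + 8L + 3)` from
`γ ≤ e^{−(3L^j+8L+3)}`, `γ·log γ⁻² ≤ 4√γ ≤ c′` from `γ ≤ (c′∕4)²`). [cite: Balaban1988Convergent, (2.4)–(2.5) p.255; Balaban1987RG1, Thm 1 p.259 («γ sufficiently small», the value); Balaban1985Averaging, Prop. 2 p.26 (bookkeeping)] -/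
private theorem ccmShape_of_le_explicitWindow (hL : 1 ≤ L) (j N : ℕ) [NeZero N] {γ : ℝ} (hγ : 0 < γ)
    (hγle : γ ≤ min (Real.exp (-(3 * (L : ℝ) ^ j + 8 * L + 3)))
      ((min (16 / (3 * 36608)) (16 * ExpMeanLog.deltaSU (Fin N) / ((8 * L : ℕ) : ℝ) ^ 2) / 4) ^ 2)) :
    γ ≤ Real.exp (-1) ∧ 3 * (L : ℝ) ^ j ≤ L * Real.log (γ ^ 2)⁻¹ ∧ ((8 * L + 3 : ℕ) : ℝ) ≤ L * Real.log (γ ^ 2)⁻¹ ∧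
      36608 * (γ * Real.log (γ ^ 2)⁻¹) ≤ 16 / 3 ∧ γ * Real.log (γ ^ 2)⁻¹ ≤ 16 * ExpMeanLog.deltaSU (Fin N) / ((8 * L : ℕ) : ℝ) ^ 2 := by
  set A : ℝ := 3 * (L : ℝ) ^ j + 8 * L + 3 with hA
  set c : ℝ := min (16 / (3 * 36608)) (16 * ExpMeanLog.deltaSU (Fin N) / ((8 * L : ℕ) : ℝ) ^ 2) with hc
  have hL' : (1 : ℝ) ≤ L := by exact_mod_cast hL
  have hδ : 0 < ExpMeanLog.deltaSU (Fin N) := ExpMeanLog.deltaSU_pos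
  have hc0 : 0 < c := lt_min (by norm_num) (by positivity)
  have hLj : (0 : ℝ) ≤ 3 * (L : ℝ) ^ j := by positivity
  have hA1 : 1 ≤ A := by rw [hA]; linarith
  have hγA : γ ≤ Real.exp (-A) := hγle.trans (min_le_left _ _)
  have hγc : γ ≤ (c / 4) ^ 2 := hγle.trans (min_le_right _ _)
  -- `log γ⁻² ≥ 2A`
  have hlog : 2 * A ≤ Real.log (γ ^ 2)⁻¹ := by
    rw [log_inv_sq]
    have : Real.log γ ≤ -A := (Real.log_le_iff_le_exp hγ).mpr hγA
    linarith
  have hLlog : 2 * A ≤ L * Real.log (γ ^ 2)⁻¹ :=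
    hlog.trans (le_mul_of_one_le_left (by linarith) hL')
  -- `γ·log γ⁻² ≤ c`
  have hγlog : γ * Real.log (γ ^ 2)⁻¹ ≤ c := by
    have h4 : Real.sqrt γ ≤ c / 4 := by
      rw [Real.sqrt_le_left (by positivity)]; exact hγc
    linarith [mul_log_inv_sq_le_four_sqrt hγ]
  refine ⟨hγA.trans (Real.exp_le_exp.mpr (by linarith)), ?_, ?_, ?_, ?_⟩
  · have : 3 * (L : ℝ) ^ j ≤ 2 * A := by rw [hA]; nlinarith
    exact this.trans hLlog
  · have : ((8 * L + 3 : ℕ) : ℝ) ≤ 2 * A := by rw [hA]; push_cast; nlinarith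
    exact this.trans hLlog
  · calc 36608 * (γ * Real.log (γ ^ 2)⁻¹) ≤ 36608 * c := by gcongr
      _ ≤ 36608 * (16 / (3 * 36608)) := by gcongr; exact min_le_left _ _
      _ = 16 / 3 := by norm_num
  · exact hγlog.trans (min_le_right _ _)

/-- **THE TWO SCALAR LETTERS OF THE EXPLICIT WINDOW, BUNDLED — THE PUBLIC FACE OF §1.**  `explicitWindow_pos` and `ccmShape_of_le_explicitWindow` above are `private`
byte-identical copies of the residue module's §1 (`…AtCRLetteredMemberDoorExplicitWindow`, red after the Stage-2 seam; the gate's dedup admits one public home per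
statement); this pair is their residue-free public reading: `0 < γ₁₁ⁿᵘᵐ(L, j, N)` ∧ on `0 < γ ≤ γ₁₁ⁿᵘᵐ(L, j, N)` the five γ-conditions `γ ≤ e^{−1}`, `3·L^j ≤ L·log γ⁻²`,
`8L + 3 ≤ L·log γ⁻²`, `36608·γ·log γ⁻² ≤ 16∕3`, `γ·log γ⁻² ≤ 16·δ_N∕(8L)²`.  Pure real arithmetic (seam-invariant).
[cite: Balaban1988Convergent, (2.4)–(2.5) p.255; Balaban1987RG1, Thm 1 p.259 («γ sufficiently small», the value); Balaban1985Averaging, Prop. 2 p.26 (bookkeeping)] -/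
theorem explicitWindowLetters (hL : 1 ≤ L) (j N : ℕ) [NeZero N] :
    0 < min (Real.exp (-(3 * (L : ℝ) ^ j + 8 * L + 3)))
      ((min (16 / (3 * 36608)) (16 * ExpMeanLog.deltaSU (Fin N) / ((8 * L : ℕ) : ℝ) ^ 2) / 4) ^ 2) ∧
    ∀ {γ : ℝ}, 0 < γ → γ ≤ min (Real.exp (-(3 * (L : ℝ) ^ j + 8 * L + 3)))
      ((min (16 / (3 * 36608)) (16 * ExpMeanLog.deltaSU (Fin N) / ((8 * L : ℕ) : ℝ) ^ 2) / 4) ^ 2) →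
      γ ≤ Real.exp (-1) ∧ 3 * (L : ℝ) ^ j ≤ L * Real.log (γ ^ 2)⁻¹ ∧ ((8 * L + 3 : ℕ) : ℝ) ≤ L * Real.log (γ ^ 2)⁻¹ ∧
        36608 * (γ * Real.log (γ ^ 2)⁻¹) ≤ 16 / 3 ∧ γ * Real.log (γ ^ 2)⁻¹ ≤ 16 * ExpMeanLog.deltaSU (Fin N) / ((8 * L : ℕ) : ℝ) ^ 2 :=
  ⟨explicitWindow_pos hL j N, fun hγ hγle => ccmShape_of_le_explicitWindow hL j N hγ hγle⟩

end Scalar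

/-! ## §2  The member's door faces keyed on `γ ≤ γ₁₁ⁿᵘᵐ(F.L, j, N)` explicit -/

section Door

variable {F : T4Family} {N : ℕ} [NeZero N] {j c₁₅ : ℕ} {γ c ε₀ ε₂₉ B₃ B₃' a₀ a₁ bl β' : ℝ} {θ₀ : Stage13Params F N} {Dat : TopData F N}

/-- **★★★★ N11's PRINTED OUTPUT AT THE cR-LETTERED MEMBER's HISTORY-BLIND DOOR ON THE EXPLICIT WINDOW** `0 < γ ≤ γ₁₁ⁿᵘᵐ(F.L, j, N)` (value in the type), `c ∈ [2, 8]`, `1 ≤ j`,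
`j + 1 ≤ F.m`, Part 14 §0c's letters, per-window-run K0 solvability + [III] §3 supplier: the door key HOLDS (g4's door theorem) ∧ for EVERY key proof `hG`, `B16.Thm1Printed` at the K1-keyed
datum of the Gaussian certificate (dag-n11-w5 p631153's door theorem with the five γ-conditions from §1).  CONDITIONAL; nothing of Bałaban asserted.
[cite: Balaban1988Convergent, Thm 1 p.262, Theorem p.245, §3 p.279, (2.4)–(2.5) p.255, (2.10) p.256, (2.28) p.259, (3.16)–(3.25) pp.268–270; Balaban1987RG1, Thm 1 p.259, (0.20) p.256, (1.20)–(1.22) p.264; Balaban1989LargeFieldII, Thm 1 p.355; Balaban1989LargeFieldI, (0.2)–(0.4) p.176; Balaban1985Variational, Thm 1 (7)–(9) pp.278–279, (144)–(152) pp.300–301, Prop. 8 p.304] -/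
theorem thm1Printed_gaussPinH_door_ccmwCR_of_le_explicitWindow
    (hθ₀ : θ₀ = theta13LiveOfNumerics F N
      ({ stage12NumericsOfThm1CCMW F.L j γ ε₀ B₃ B₃' a₀ a₁ with s2 := { sect2NumericsOfThm1C F.L with cR := c } } : Stage12Numerics) ε₂₉
      (zeta316OfRecord F N (stage12NumericsOfThm1CCMW F.L j γ ε₀ B₃ B₃' a₀ a₁).ν (stage12NumericsOfThm1CCMW F.L j γ ε₀ B₃ B₃' a₀ a₁).τ9.M
        (stage12NumericsOfThm1CCMW F.L j γ ε₀ B₃ B₃' a₀ a₁).A₁) (RzOfRecord F N) (ZtOfRecord F N))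
    (hjm : j + 1 ≤ F.m) (hc2 : 2 ≤ c) (hc8 : c ≤ 8) (hj : 1 ≤ j) (hε : 0 < ε₀) (hε' : 0 < ε₂₉) (hB : 0 ≤ B₃) (hB' : 0 ≤ B₃') (ha₀ : 0 < a₀) (ha₁ : 0 < a₁)
    (hγ0 : 0 < γ) (hγle : γ ≤ min (Real.exp (-(3 * (F.L : ℝ) ^ j + 8 * F.L + 3)))
      ((min (16 / (3 * 36608)) (16 * ExpMeanLog.deltaSU (Fin N) / ((8 * F.L : ℕ) : ℝ) ^ 2) / 4) ^ 2))
    (h15 : VariationalThm1RegSepCoP7MGB F N (floorGuard F c₁₅) (lamDatum F) Dat B₃ a₀ a₁) (hc₁₅ : c₁₅ ≤ F.L ^ j)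
    (h9 : Gauge9RegSepTopStepGB F N (fun ν K Ω => suppDomOfRecord F ν K Ω) (F.L ^ j) (floorGuard F c₁₅) (lamDatum F) Dat B₃ B₃' a₀ a₁)
    (hDat₀ : ∀ (θ' : Stage13Params F N) (p : B12.RunParams) (n : ℕ) (s : SeqOfRecord F θ'.ν θ'.τ9.M (gOfRecord₁₃ F N θ' p) p.K n) (δ : ℕ → ℝ) (W : MSField (F.P p.K) (SU N)),
      n ≤ p.K → Sect2.DataSmall7PTop (avOfRecord F N p.K) s.Ω (suppDomOfRecord F θ'.ν p.K s.Ω) n δ W → Dat p.K s.Ω (suppDomOfRecord F θ'.ν p.K s.Ω) n δ W)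
    (hseam : ∀ (θ' : Stage13Params F N) (p : B12.RunParams) (n : ℕ) (s : SeqOfRecord F θ'.ν θ'.τ9.M (gOfRecord₁₃ F N θ' p) p.K (n + 1)) (W : MSField (F.P p.K) (SU N)),
      UbgOfRecord₁₃CoP F N θ' p (n + 1) s W = UbgMSCoPOfRecordB F N θ'.ν θ'.τ9.M (gOfRecord₁₃ F N θ' p) p.K (n + 1) s W)
    (hbox : BetaLowerH bl γ (betaOfRecord₁₃ F N (theta13OfThm1CCMW F N j γ ε₀ ε₂₉ B₃ B₃' a₀ a₁)))
    (hbox' : BetaUpperH β' γ (betaOfRecord₁₃ F N (theta13OfThm1CCMW F N j γ ε₀ ε₂₉ B₃ B₃' a₀ a₁))) (hl : -bl * γ ^ 2 ≤ 3) (hβ' : β' * γ ^ 2 ≤ 3 / 4)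
    (hsolv : ∀ P : B12.RunParams, Step.InInterval γ P.K (gOfRecord₁₃ F N θ₀ P) → ∀ i, 1 ≤ i → i ≤ P.K →
      ∀ (s : SeqOfRecord F θ₀.ν θ₀.τ9.M (gOfRecord₁₃ F N θ₀ P) P.K i) (V : GaugeField (F.P P.K) i (SU N)),
      chiSeqOfRecord F N θ₀.ν θ₀.τ9.M (gOfRecord₁₃ F N θ₀ P) P.K i s V ≠ 0 →
      ∀ a ∈ cubesIn (fun a : ↥(cubeIndices (F.P P.K) (cubeSide (F.P P.K).L θ₀.ν.M₂ (RkOfRecord (F.P P.K).L θ₀.ν.r (gOfRecord₁₃ F N θ₀ P i)) i)) =>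
          cubeEnl (F.P P.K) (cubeSide (F.P P.K).L θ₀.ν.M₂ (RkOfRecord (F.P P.K).L θ₀.ν.r (gOfRecord₁₃ F N θ₀ P i)) i) a 0) (s.Ω i),
        ∃ U₀, IsMinimizer (avOfRecord F N P.K) {U | PlaqSmall (θ₀.ν.εreg * (F.P P.K).eta i ^ 2) U}
          (Bj θ₀.ν.M₁ (cubeEnl (F.P P.K) (cubeSide (F.P P.K).L θ₀.ν.M₂ (RkOfRecord (F.P P.K).L θ₀.ν.r (gOfRecord₁₃ F N θ₀ P i)) i) a 4) i)
          (avgFamily (avOfRecord F N P.K) (qsstarGIter0 i V)) U₀)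
    (σ : (P : B12.RunParams) → Sect3Supplier (gaussPinH (Stage13HParams.ofHistoryBlind F N ⟨θ₀, ZrOfRecord₁₃ F N θ₀⟩)) P)
    (hσ : ∀ P : B12.RunParams, Step.InInterval γ P.K (gOfRecord₁₃ F N θ₀ P) → SupplierObligations (gaussPinH (Stage13HParams.ofHistoryBlind F N ⟨θ₀, ZrOfRecord₁₃ F N θ₀⟩)) P (σ P))
    (hσB : ∀ P : B12.RunParams, Step.InInterval γ P.K (gOfRecord₁₃ F N θ₀ P) → SupplierBorel (gaussPinH (Stage13HParams.ofHistoryBlind F N ⟨θ₀, ZrOfRecord₁₃ F N θ₀⟩)) P (σ P)) :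
    (Stage13HParams.ofHistoryBlind F N ⟨θ₀, ZrOfRecord₁₃ F N θ₀⟩).Provisos₁₃SepCoPH F N ∧
    ∀ hG : (Stage13HParams.ofHistoryBlind F N ⟨θ₀, ZrOfRecord₁₃ F N θ₀⟩).Provisos₁₃SepCoPH F N,
      B16.Thm1Printed (datumOfRecord₁₃SepCoPH F N (gaussPinH (Stage13HParams.ofHistoryBlind F N ⟨θ₀, ZrOfRecord₁₃ F N θ₀⟩)) (provisos₁₃SepCoPH_gaussPinH hG)).C := by
  obtain ⟨hγe, h3γ, hRγ, hε3γ, hε2γ⟩ := ccmShape_of_le_explicitWindow (L := F.L) F.hL.2.le j N hγ0 hγle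
  exact ⟨provisos₁₃SepCoPH_door_ccmwCR_of_gauge9TopStepGB_of_betaBoxSignFree_allTorus_lam hθ₀ (by linarith) hc8 hγ0
      (hγe.trans (Real.exp_neg_one_lt_d9.le.trans (by norm_num))) hε hε' hB hB' ha₀ ha₁ h15 h9 (hAdm_floorGuard_ccmwCR hθ₀ hc₁₅) (fun θ' p n s δ W hn _ h => hDat₀ θ' p n s δ W hn h) hseam hbox hbox' hl hβ',
    fun _ => thm1Printed_gaussPinH_door_ccmwCR_of_supplierBorel_of_solvable_of_hjm hθ₀ hjm hc2 hc8 hj hε hε' hB hB' ha₀ ha₁ hγ0 hγe h3γ hRγ hε3γ hε2γ h15 hc₁₅ h9 hDat₀ hseam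
      hbox hbox' hl hβ' hsolv σ hσ hσB⟩

/-- **★★★★ THEOREM 1 OF [III] ALONG THE RUN AND THE THEOREM OF p. 245 IN LAW FORM AT THE MEMBER's DOOR ON THE EXPLICIT WINDOW** `0 < γ ≤ γ₁₁ⁿᵘᵐ(F.L, j, N)` (value in the type),
per window run: `∀ k ≤ K, SLaw₁₃CoPH θᴳ_c p k` ∧ `∀ k < K, SLaw → TLaw` — this seat's p631283 §2 with the five γ-conditions from §1.  Displayed: Part 14 §0c's letters, `c ∈ [2, 8]`, `1 ≤ j`,
`j + 1 ≤ F.m`, per-run K0 solvability + [III] §3 supplier.  CONDITIONAL; nothing of Bałaban asserted.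
[cite: Balaban1988Convergent, Thm 1 p.262, Theorem p.245, remark p.262, §3 p.279, (2.4)–(2.5) p.255, (2.10) p.256, (2.28) p.259, (3.16)–(3.25) pp.268–270; Balaban1987RG1, Thm 1 p.259, (0.20) p.256, (1.20)–(1.22) p.264; Balaban1989LargeFieldI, (0.2)–(0.4) p.176, p.177 (i)–(ii); Balaban1985Variational, Thm 1 (7)–(9) pp.278–279, (144)–(152) pp.300–301] -/
theorem thmP245Laws_gaussPinH_door_ccmwCR_of_le_explicitWindow
    (hθ₀ : θ₀ = theta13LiveOfNumerics F N
      ({ stage12NumericsOfThm1CCMW F.L j γ ε₀ B₃ B₃' a₀ a₁ with s2 := { sect2NumericsOfThm1C F.L with cR := c } } : Stage12Numerics) ε₂₉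
      (zeta316OfRecord F N (stage12NumericsOfThm1CCMW F.L j γ ε₀ B₃ B₃' a₀ a₁).ν (stage12NumericsOfThm1CCMW F.L j γ ε₀ B₃ B₃' a₀ a₁).τ9.M
        (stage12NumericsOfThm1CCMW F.L j γ ε₀ B₃ B₃' a₀ a₁).A₁) (RzOfRecord F N) (ZtOfRecord F N))
    (hjm : j + 1 ≤ F.m) (hc2 : 2 ≤ c) (hc8 : c ≤ 8) (hj : 1 ≤ j) (hε : 0 < ε₀) (hε' : 0 < ε₂₉) (hB : 0 ≤ B₃) (hB' : 0 ≤ B₃') (ha₀ : 0 < a₀) (ha₁ : 0 < a₁)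
    (hγ0 : 0 < γ) (hγle : γ ≤ min (Real.exp (-(3 * (F.L : ℝ) ^ j + 8 * F.L + 3)))
      ((min (16 / (3 * 36608)) (16 * ExpMeanLog.deltaSU (Fin N) / ((8 * F.L : ℕ) : ℝ) ^ 2) / 4) ^ 2))
    (h15 : VariationalThm1RegSepCoP7MGB F N (floorGuard F c₁₅) (lamDatum F) Dat B₃ a₀ a₁) (hc₁₅ : c₁₅ ≤ F.L ^ j)
    (h9 : Gauge9RegSepTopStepGB F N (fun ν K Ω => suppDomOfRecord F ν K Ω) (F.L ^ j) (floorGuard F c₁₅) (lamDatum F) Dat B₃ B₃' a₀ a₁)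
    (hDat₀ : ∀ (θ' : Stage13Params F N) (p : B12.RunParams) (n : ℕ) (s : SeqOfRecord F θ'.ν θ'.τ9.M (gOfRecord₁₃ F N θ' p) p.K n) (δ : ℕ → ℝ) (W : MSField (F.P p.K) (SU N)),
      n ≤ p.K → Sect2.DataSmall7PTop (avOfRecord F N p.K) s.Ω (suppDomOfRecord F θ'.ν p.K s.Ω) n δ W → Dat p.K s.Ω (suppDomOfRecord F θ'.ν p.K s.Ω) n δ W)
    (hseam : ∀ (θ' : Stage13Params F N) (p : B12.RunParams) (n : ℕ) (s : SeqOfRecord F θ'.ν θ'.τ9.M (gOfRecord₁₃ F N θ' p) p.K (n + 1)) (W : MSField (F.P p.K) (SU N)),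
      UbgOfRecord₁₃CoP F N θ' p (n + 1) s W = UbgMSCoPOfRecordB F N θ'.ν θ'.τ9.M (gOfRecord₁₃ F N θ' p) p.K (n + 1) s W)
    (hbox : BetaLowerH bl γ (betaOfRecord₁₃ F N (theta13OfThm1CCMW F N j γ ε₀ ε₂₉ B₃ B₃' a₀ a₁)))
    (hbox' : BetaUpperH β' γ (betaOfRecord₁₃ F N (theta13OfThm1CCMW F N j γ ε₀ ε₂₉ B₃ B₃' a₀ a₁))) (hl : -bl * γ ^ 2 ≤ 3) (hβ' : β' * γ ^ 2 ≤ 3 / 4)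
    (p : B12.RunParams) (hw : Step.InInterval γ p.K (gOfRecord₁₃ F N θ₀ p))
    (hsolv : ∀ i, 1 ≤ i → i ≤ p.K → ∀ (s : SeqOfRecord F θ₀.ν θ₀.τ9.M (gOfRecord₁₃ F N θ₀ p) p.K i) (V : GaugeField (F.P p.K) i (SU N)),
      chiSeqOfRecord F N θ₀.ν θ₀.τ9.M (gOfRecord₁₃ F N θ₀ p) p.K i s V ≠ 0 →
      ∀ a ∈ cubesIn (fun a : ↥(cubeIndices (F.P p.K) (cubeSide (F.P p.K).L θ₀.ν.M₂ (RkOfRecord (F.P p.K).L θ₀.ν.r (gOfRecord₁₃ F N θ₀ p i)) i)) =>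
          cubeEnl (F.P p.K) (cubeSide (F.P p.K).L θ₀.ν.M₂ (RkOfRecord (F.P p.K).L θ₀.ν.r (gOfRecord₁₃ F N θ₀ p i)) i) a 0) (s.Ω i),
        ∃ U₀, IsMinimizer (avOfRecord F N p.K) {U | PlaqSmall (θ₀.ν.εreg * (F.P p.K).eta i ^ 2) U}
          (Bj θ₀.ν.M₁ (cubeEnl (F.P p.K) (cubeSide (F.P p.K).L θ₀.ν.M₂ (RkOfRecord (F.P p.K).L θ₀.ν.r (gOfRecord₁₃ F N θ₀ p i)) i) a 4) i)
          (avgFamily (avOfRecord F N p.K) (qsstarGIter0 i V)) U₀)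
    (σ : Sect3Supplier (gaussPinH (Stage13HParams.ofHistoryBlind F N ⟨θ₀, ZrOfRecord₁₃ F N θ₀⟩)) p)
    (hσ : SupplierObligations (gaussPinH (Stage13HParams.ofHistoryBlind F N ⟨θ₀, ZrOfRecord₁₃ F N θ₀⟩)) p σ)
    (hσB : SupplierBorel (gaussPinH (Stage13HParams.ofHistoryBlind F N ⟨θ₀, ZrOfRecord₁₃ F N θ₀⟩)) p σ) :
    (∀ k, k ≤ p.K → SLaw₁₃CoPH F N (gaussPinH (Stage13HParams.ofHistoryBlind F N ⟨θ₀, ZrOfRecord₁₃ F N θ₀⟩)) p k) ∧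
    (∀ k, k < p.K → SLaw₁₃CoPH F N (gaussPinH (Stage13HParams.ofHistoryBlind F N ⟨θ₀, ZrOfRecord₁₃ F N θ₀⟩)) p k →
      TLaw₁₃CoPH F N (gaussPinH (Stage13HParams.ofHistoryBlind F N ⟨θ₀, ZrOfRecord₁₃ F N θ₀⟩)) p k) := by
  obtain ⟨hγe, h3γ, hRγ, hε3γ, hε2γ⟩ := ccmShape_of_le_explicitWindow (L := F.L) F.hL.2.le j N hγ0 hγle
  exact thmP245Laws_gaussPinH_door_ccmwCR_of_supplierBorel_of_betaBox hθ₀ hjm hc2 hc8 hj hε hε' hB hB' ha₀ ha₁ hγ0 hγe h3γ hRγ hε3γ hε2γ h15 hc₁₅ h9 hDat₀ hseam hbox hbox' hl hβ'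
    p hw hsolv σ hσ hσB

/-- **★★★★ dag-n24-c's `h11` FAMILY AT THE MEMBER's DOOR ON THE EXPLICIT WINDOW** `0 < γ ≤ γ₁₁ⁿᵘᵐ(F.L, j, N)` (value in the type): the door key HOLDS ∧ for EVERY key proof `hG`, the
`h11`-shaped (S1ᵀ) family at the datum keyed by `hG` (this seat's p634779 §3 with the five γ-conditions from §1; inner witness `γ₁₁ := γ`).  Displayed: Part 14 §0c's letters, `c ∈ [2, 8]`,
`1 ≤ j`, `j + 1 ≤ F.m`, per-window-run K0 solvability + [III] §3 supplier.  CONDITIONAL; nothing of Bałaban asserted; no v9 stub touched.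
[cite: Balaban1988Convergent, Theorem p.245, Thm 1 p.262, remark p.262, p.244 L36–38, §3 p.279, (2.4)–(2.6) p.255, (2.10) p.256, (2.28) p.259; Balaban1989LargeFieldII, Thm 1 + (0.1) pp.355–356; Balaban1989LargeFieldI, (0.2)–(0.4) p.176, p.177 (i)–(ii); Balaban1985Variational, Thm 1 (7)–(9) pp.278–279, (144)–(152) pp.300–301, Prop. 8 p.304; Balaban1987RG1, Thm 1 p.259, (0.20) p.256, (1.20)–(1.22) p.264] -/
theorem h11Family_gaussPinH_door_ccmwCR_of_le_explicitWindow
    (hθ₀ : θ₀ = theta13LiveOfNumerics F N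
      ({ stage12NumericsOfThm1CCMW F.L j γ ε₀ B₃ B₃' a₀ a₁ with s2 := { sect2NumericsOfThm1C F.L with cR := c } } : Stage12Numerics) ε₂₉
      (zeta316OfRecord F N (stage12NumericsOfThm1CCMW F.L j γ ε₀ B₃ B₃' a₀ a₁).ν (stage12NumericsOfThm1CCMW F.L j γ ε₀ B₃ B₃' a₀ a₁).τ9.M
        (stage12NumericsOfThm1CCMW F.L j γ ε₀ B₃ B₃' a₀ a₁).A₁) (RzOfRecord F N) (ZtOfRecord F N))
    (hjm : j + 1 ≤ F.m) (hc2 : 2 ≤ c) (hc8 : c ≤ 8) (hj : 1 ≤ j) (hε : 0 < ε₀) (hε' : 0 < ε₂₉) (hB : 0 ≤ B₃) (hB' : 0 ≤ B₃') (ha₀ : 0 < a₀) (ha₁ : 0 < a₁)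
    (hγ0 : 0 < γ) (hγle : γ ≤ min (Real.exp (-(3 * (F.L : ℝ) ^ j + 8 * F.L + 3)))
      ((min (16 / (3 * 36608)) (16 * ExpMeanLog.deltaSU (Fin N) / ((8 * F.L : ℕ) : ℝ) ^ 2) / 4) ^ 2))
    (h15 : VariationalThm1RegSepCoP7MGB F N (floorGuard F c₁₅) (lamDatum F) Dat B₃ a₀ a₁) (hc₁₅ : c₁₅ ≤ F.L ^ j)
    (h9 : Gauge9RegSepTopStepGB F N (fun ν K Ω => suppDomOfRecord F ν K Ω) (F.L ^ j) (floorGuard F c₁₅) (lamDatum F) Dat B₃ B₃' a₀ a₁)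
    (hDat₀ : ∀ (θ' : Stage13Params F N) (p : B12.RunParams) (n : ℕ) (s : SeqOfRecord F θ'.ν θ'.τ9.M (gOfRecord₁₃ F N θ' p) p.K n) (δ : ℕ → ℝ) (W : MSField (F.P p.K) (SU N)),
      n ≤ p.K → Sect2.DataSmall7PTop (avOfRecord F N p.K) s.Ω (suppDomOfRecord F θ'.ν p.K s.Ω) n δ W → Dat p.K s.Ω (suppDomOfRecord F θ'.ν p.K s.Ω) n δ W)
    (hseam : ∀ (θ' : Stage13Params F N) (p : B12.RunParams) (n : ℕ) (s : SeqOfRecord F θ'.ν θ'.τ9.M (gOfRecord₁₃ F N θ' p) p.K (n + 1)) (W : MSField (F.P p.K) (SU N)),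
      UbgOfRecord₁₃CoP F N θ' p (n + 1) s W = UbgMSCoPOfRecordB F N θ'.ν θ'.τ9.M (gOfRecord₁₃ F N θ' p) p.K (n + 1) s W)
    (hbox : BetaLowerH bl γ (betaOfRecord₁₃ F N (theta13OfThm1CCMW F N j γ ε₀ ε₂₉ B₃ B₃' a₀ a₁)))
    (hbox' : BetaUpperH β' γ (betaOfRecord₁₃ F N (theta13OfThm1CCMW F N j γ ε₀ ε₂₉ B₃ B₃' a₀ a₁))) (hl : -bl * γ ^ 2 ≤ 3) (hβ' : β' * γ ^ 2 ≤ 3 / 4)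
    (hsolv : ∀ P : B12.RunParams, Step.InInterval γ P.K (gOfRecord₁₃ F N θ₀ P) → ∀ i, 1 ≤ i → i ≤ P.K →
      ∀ (s : SeqOfRecord F θ₀.ν θ₀.τ9.M (gOfRecord₁₃ F N θ₀ P) P.K i) (V : GaugeField (F.P P.K) i (SU N)),
      chiSeqOfRecord F N θ₀.ν θ₀.τ9.M (gOfRecord₁₃ F N θ₀ P) P.K i s V ≠ 0 →
      ∀ a ∈ cubesIn (fun a : ↥(cubeIndices (F.P P.K) (cubeSide (F.P P.K).L θ₀.ν.M₂ (RkOfRecord (F.P P.K).L θ₀.ν.r (gOfRecord₁₃ F N θ₀ P i)) i)) =>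
          cubeEnl (F.P P.K) (cubeSide (F.P P.K).L θ₀.ν.M₂ (RkOfRecord (F.P P.K).L θ₀.ν.r (gOfRecord₁₃ F N θ₀ P i)) i) a 0) (s.Ω i),
        ∃ U₀, IsMinimizer (avOfRecord F N P.K) {U | PlaqSmall (θ₀.ν.εreg * (F.P P.K).eta i ^ 2) U}
          (Bj θ₀.ν.M₁ (cubeEnl (F.P P.K) (cubeSide (F.P P.K).L θ₀.ν.M₂ (RkOfRecord (F.P P.K).L θ₀.ν.r (gOfRecord₁₃ F N θ₀ P i)) i) a 4) i)
          (avgFamily (avOfRecord F N P.K) (qsstarGIter0 i V)) U₀)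
    (σ : (P : B12.RunParams) → Sect3Supplier (gaussPinH (Stage13HParams.ofHistoryBlind F N ⟨θ₀, ZrOfRecord₁₃ F N θ₀⟩)) P)
    (hσ : ∀ P : B12.RunParams, Step.InInterval γ P.K (gOfRecord₁₃ F N θ₀ P) → SupplierObligations (gaussPinH (Stage13HParams.ofHistoryBlind F N ⟨θ₀, ZrOfRecord₁₃ F N θ₀⟩)) P (σ P))
    (hσB : ∀ P : B12.RunParams, Step.InInterval γ P.K (gOfRecord₁₃ F N θ₀ P) → SupplierBorel (gaussPinH (Stage13HParams.ofHistoryBlind F N ⟨θ₀, ZrOfRecord₁₃ F N θ₀⟩)) P (σ P)) :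
    (Stage13HParams.ofHistoryBlind F N ⟨θ₀, ZrOfRecord₁₃ F N θ₀⟩).Provisos₁₃SepCoPH F N ∧
    ∀ hG : (Stage13HParams.ofHistoryBlind F N ⟨θ₀, ZrOfRecord₁₃ F N θ₀⟩).Provisos₁₃SepCoPH F N,
    ∀ βup β₀ : ℝ, ∃ γ₁₁ : ℝ, 0 < γ₁₁ ∧ ∀ w : WorldP,
      w.C = (datumOfRecord₁₃SepCoPH F N (gaussPinH (Stage13HParams.ofHistoryBlind F N ⟨θ₀, ZrOfRecord₁₃ F N θ₀⟩)) (provisos₁₃SepCoPH_gaussPinH hG)).C →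
      w.βup = βup → w.β₀ = β₀ → w.γ ≤ γ₁₁ →
      ∀ P : B12.RunParams, (leavesP w P).b7 → (leavesP w P).b8 → (leavesP w P).b9 → (leavesP w P).b10 → (leavesP w P).b11 →
      (leavesP w P).smallCouplings → (leavesP w P).smallFieldInductive → (leavesP w P).flowControl →
        ∀ k, k < P.K → SLaw₁₃CoPH F N (gaussPinH (Stage13HParams.ofHistoryBlind F N ⟨θ₀, ZrOfRecord₁₃ F N θ₀⟩)) P k →
          TLaw₁₃CoPH F N (gaussPinH (Stage13HParams.ofHistoryBlind F N ⟨θ₀, ZrOfRecord₁₃ F N θ₀⟩)) P k := by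
  obtain ⟨hγe, h3γ, hRγ, hε3γ, hε2γ⟩ := ccmShape_of_le_explicitWindow (L := F.L) F.hL.2.le j N hγ0 hγle
  exact ⟨provisos₁₃SepCoPH_door_ccmwCR_of_gauge9TopStepGB_of_betaBoxSignFree_allTorus_lam hθ₀ (by linarith) hc8 hγ0
      (hγe.trans (Real.exp_neg_one_lt_d9.le.trans (by norm_num))) hε hε' hB hB' ha₀ ha₁ h15 h9 (hAdm_floorGuard_ccmwCR hθ₀ hc₁₅) (fun θ' p n s δ W hn _ h => hDat₀ θ' p n s δ W hn h) hseam hbox hbox' hl hβ',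
    fun hG => h11Family_gaussPinH_door_ccmwCR_of_supplierBorel_of_betaBox hθ₀ hjm hc2 hc8 hj hε hε' hB hB' ha₀ ha₁ hγ0 hγe h3γ hRγ hε3γ hε2γ h15 hc₁₅ h9 hDat₀ hseam
      hbox hbox' hl hβ' hsolv σ hσ hσB hG⟩

end Door

end Summit.QuantumFields.YangMills.Theorems.BalabanUVNodesN11AtCRLetteredMemberDoorExplicitWindowB

end
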